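import Literature.Analysis.SegalBargmann.SchwartzCompactWeilRep
import HarnessLib

/-!
# The Fourier transform on `𝓢(ℝⁿ)` is the oscillator-torus element `θ = (−π/2, …, −π/2)` = `μ₀(i·1)|_𝓢` (Folland 1989, §1.7, Prop. (4.39))

Topic `Analysis/SegalBargmann`; namespace `Literature.Analysis.SegalBargmann`.  The tree knows `𝓕 h_α = (−i)^{|α|} h_α`
(`HermiteFourier.fourier_hermiteSchwartz_herm`) and `𝓕 = T_{(−i)^{|β|}}` as a Hermite multiplier
(`HermiteOscillatorTorus.fourier_eq_hermiteMultiplierCLM`).  Since `(−i)^{|β|} = e^{i θ·β}` for `θ = (−π/2, …, −π/2)`, the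
Fourier transform IS a torus operator, hence (files `SchwartzTorusIdentification` / `SchwartzUnitaryIdentification` /
`SchwartzCompactWeilRep`) the Schwartz restriction of the metaplectic action of the unitary SCALAR `i ∈ U(σ)`:

* `torusPhase_negHalfPi : torusPhase (−π/2) β = (−i)^{|β|}`, `fourier_eq_torusOpCLM : 𝓕 f = torusOpCLM (−π/2) f`;
* on the Folland carrier: `fourierPi : 𝓢(ℝ^σ, ℂ) →L[ℂ] 𝓢(ℝ^σ, ℂ) := torusOpPi (−π/2)`, `fourierPi_apply` (= the transport of
  Mathlib's `𝓕`), `fourierPi_hermitePi : fourierPi h_α = (−i)^{|α|} • h_α`;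
* `torusPt_negHalfPi : torusPt (−π/2) = (i)_l`, **`fourierPi_eq_unitaryOpPi : fourierPi = unitaryOpPi (diagHom fun _ => Circle.exp (π/2))`**
  (the scalar `i`), **`toL2_fourierPi : toL2 (fourierPi f) = schrodingerU (diagHom (i)) (toL2 f)`** — Plancherel's unitary
  on `L²(ℝ^σ)` restricted to `𝓢` in the rigidity lane's vocabulary (`liftsTo_fourierPi`);
* **Heisenberg covariance of `𝓕` for free**: `fourierPi (ρ(p,q) f) = ρ(−q, p) (fourierPi f)` (`fourierPi_rhoS`, from
  `isRhoCovariantS_compactWeilRep` at the scalar `i`: `realify (i·1) (p,q) = (−q,p)`);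
* powers: `fourierPi ∘ fourierPi = torusOpPi (−π)` (parity operator, `h_α ↦ (−1)^{|α|} h_α`), `fourierPi⁴ = 1`.

Everything is proved from the imported tree files; no cited statement is used as a hypothesis.  Use (pub-hodgecm, node
W2-∞-zp (K′)): the "opposite unipotent" `𝓕⁻¹ M 𝓕` on the Folland carrier needs `𝓕` there with its `L²` lift and its
Heisenberg covariance — all three are corollaries here, no second construction of `𝓕` on `σ → ℝ`.

## References

* [Folland1989] G. B. Folland, *Harmonic Analysis in Phase Space*, Princeton UP (1989), §1.7 (`𝓕 h_α = (−i)^{|α|} h_α`),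
  Prop. (4.39) and the remark after it (`𝓕 = μ(J)` up to the eighth root of unity; on `U(n)` the scalar `i`).
  [cite: Folland1989, Prop (4.39)]

## Provenance

LEAN-IN-TREE rule (2026-08-18), pub-hodgecm model-construction sub-cell, seat mc-binder-2 gen 2.
-/

set_option autoImplicit false

noncomputable section

open MeasureTheory Complex SchwartzMap Filter Topology
open scoped InnerProductSpace ComplexConjugate Real BigOperators FourierTransform

namespace Literature.Analysis.SegalBargmann

variable {σ : Type*} [Fintype σ] [DecidableEq σ]

local notation "L2R" σ => Lp ℂ 2 (volume : Measure (σ → ℝ))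
local notation "SR" σ => SchwartzMap (σ → ℝ) ℂ
local notation "SE" σ => SchwartzMap (EuclideanSpace ℝ σ) ℂ

/-! ## §1  `𝓕` is the torus operator at `θ = −π/2` -/

section Euclidean

omit [DecidableEq σ] in
/-- `e^{i(−π/2)·|β|} = (−i)^{|β|}`: the torus phase at `θ = (−π/2, …, −π/2)` is the Fourier multiplier. [folklore] -/
theorem torusPhase_negHalfPi (β : σ →₀ ℕ) :
    torusPhase (fun _ : σ => -(π / 2)) β = (-I) ^ β.degree := by
  have hI : (-I : ℂ) = Complex.exp (-(π / 2) * I) := by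
    rw [neg_mul, Complex.exp_neg, Complex.exp_pi_div_two_mul_I, Complex.inv_I]
  rw [torusPhase, hI, ← Complex.exp_nat_mul, degree_eq_mdeg, mdeg]
  congr 1
  push_cast
  rw [Finset.sum_mul, Finset.sum_mul]
  exact Finset.sum_congr rfl fun j _ => by ring

/-- **The Fourier transform is the oscillator-torus element `θ = −π/2`** on `𝓢(EuclideanSpace ℝ σ, ℂ)`:
`𝓕 = e^{−i(π/2)N}`. [cite: Folland1989, §1.7] -/
theorem fourier_eq_torusOpCLM (f : SE σ) : 𝓕 f = torusOpCLM (fun _ : σ => -(π / 2)) f := by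
  rw [fourier_eq_hermiteMultiplierCLM, torusOpCLM]
  exact hermiteMultiplierCLM_congr _ _ (fun β => (torusPhase_negHalfPi β).symm) f

end Euclidean

/-! ## §2  The Fourier transform on the Folland carrier and its `L²` lift -/

section Pi

/-- **The Fourier transform on `𝓢(ℝ^σ, ℂ)`** (Folland carrier), as the torus operator at `−π/2`; by `fourierPi_apply` it
is the transport of Mathlib's `𝓕` on `𝓢(EuclideanSpace ℝ σ, ℂ)`. [cite: Folland1989, §1.7] -/
def fourierPi : (SR σ) →L[ℂ] SR σ := torusOpPi (fun _ : σ => -(π / 2))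

/-- `fourierPi f = e^* (𝓕 ((e^*)⁻¹ f))` for the carrier transport `e = euclE σ`. [folklore] -/
theorem fourierPi_apply (f : SR σ) :
    fourierPi f = schwartzTransport (euclE σ) (𝓕 ((schwartzTransport (euclE σ)).symm f)) := by
  rw [fourierPi, torusOpPi_apply, fourier_eq_torusOpCLM]

/-- **`𝓕 h_α = (−i)^{|α|} h_α`** on the Folland carrier. [cite: Folland1989, §1.7] -/
theorem fourierPi_hermitePi (α : σ →₀ ℕ) : fourierPi (hermitePi α) = (-I) ^ α.degree • (hermitePi α : SR σ) := by
  rw [fourierPi, torusOpPi_hermitePi, torusPhase_negHalfPi]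

omit [Fintype σ] [DecidableEq σ] in
/-- The torus point of `θ = −π/2` is the scalar `i`: `torusPt (−π/2) l = e^{iπ/2} = i`. [folklore] -/
theorem coe_torusPt_negHalfPi (l : σ) : ((torusPt (fun _ : σ => -(π / 2)) l : Circle) : ℂ) = I := by
  rw [torusPt, neg_neg, Circle.coe_exp, Complex.ofReal_div, Complex.ofReal_ofNat, Complex.exp_pi_div_two_mul_I]

omit [Fintype σ] [DecidableEq σ] in
/-- `torusPt (−π/2) = (Circle.exp (π/2))_l`. [folklore] -/
theorem torusPt_negHalfPi : torusPt (fun _ : σ => -(π / 2)) = fun _ : σ => Circle.exp (π / 2) := by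
  funext l
  rw [torusPt, neg_neg]

/-- **`𝓕 = μ₀(i·1)|_𝓢`**: the Fourier transform on `𝓢(ℝ^σ)` is the block operator of the unitary scalar `i ∈ U(σ)`.
[cite: Folland1989, Prop (4.39)] -/
theorem fourierPi_eq_unitaryOpPi :
    (fourierPi : (SR σ) →L[ℂ] SR σ) = unitaryOpPi (diagHom fun _ : σ => Circle.exp (π / 2)) := by
  rw [fourierPi, ← unitaryOpPi_diagHom_torusPt, torusPt_negHalfPi]

/-- **Plancherel's unitary restricted to `𝓢`, in the rigidity lane's vocabulary**: `toL2 (𝓕 f) = μ₀(i·1) (toL2 f)`.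
[cite: Folland1989, Prop (4.39)] -/
theorem toL2_fourierPi (f : SR σ) :
    toL2 (fourierPi f) = schrodingerU (diagHom fun _ : σ => Circle.exp (π / 2)) (toL2 f) := by
  rw [fourierPi_eq_unitaryOpPi, toL2_unitaryOpPi]

/-- `LiftsTo` form of `toL2_fourierPi`. [cite: Folland1989, Prop (4.39)] -/
theorem liftsTo_fourierPi :
    LiftsTo ((fourierPi : (SR σ) →L[ℂ] SR σ) : (SR σ) →ₗ[ℂ] SR σ)
      (((schrodingerU (diagHom fun _ : σ => Circle.exp (π / 2))).toContinuousLinearEquiv :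
        (L2R σ) ≃L[ℂ] L2R σ) : (L2R σ) →L[ℂ] L2R σ) :=
  fun f => toL2_fourierPi f

/-- The Fourier transform fixes the Gaussian on `𝓢(ℝ^σ)`. [cite: Folland1989, §1.7] -/
theorem fourierPi_hermitePi_zero : fourierPi (hermitePi (0 : σ →₀ ℕ)) = hermitePi 0 := by
  rw [fourierPi_hermitePi, map_zero, pow_zero, one_smul]

end Pi

/-! ## §3  Heisenberg covariance and powers of `𝓕` -/

section Covariance

/-- The phase-space map of the scalar `i`: `i (p + iq) = −q + ip`, i.e. `realify (i·1) (p,q) = (−q, p)`. [folklore] -/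
theorem realify_diagHom_I (p q : σ → ℝ) :
    realify (diagHom fun _ : σ => Circle.exp (π / 2)) (p, q) = (-q, p) := by
  have hcoe : ((diagHom fun _ : σ => Circle.exp (π / 2) : Matrix.unitaryGroup σ ℂ) : Matrix σ σ ℂ) =
      Matrix.diagonal fun _ => I := by
    change Matrix.diagonal (fun l => ((Circle.exp (π / 2) : Circle) : ℂ)) = _
    congr 1
    funext l
    rw [Circle.coe_exp, Complex.ofReal_div, Complex.ofReal_ofNat, Complex.exp_pi_div_two_mul_I]
  simp only [realify, hcoe, Matrix.mulVec_diagonal, phasePt_apply]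
  refine Prod.ext (funext fun k => ?_) (funext fun k => ?_)
  · simp [Complex.mul_re, Pi.neg_apply]
  · simp [Complex.mul_im]

/-- **Heisenberg covariance of the Fourier transform**: `𝓕 (ρ(p,q) f) = ρ(−q, p) (𝓕 f)` on `𝓢(ℝ^σ)` — a special case of
`isRhoCovariantS_compactWeilRep` (no separate computation). [cite: Folland1989, §4.2, (4.23)] -/
theorem fourierPi_rhoS (p q : σ → ℝ) (f : SR σ) :
    fourierPi (rhoS p q f) = rhoS (-q) p (fourierPi f) := by
  have h := isRhoCovariantS_compactWeilRep (MonoidHom.id (Matrix.unitaryGroup σ ℂ)) 1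
    (diagHom fun _ : σ => Circle.exp (π / 2)) p q f
  simp only [compactWeilRep_apply, MonoidHom.one_apply, Circle.coe_one, one_smul, MonoidHom.id_apply,
    realify_diagHom_I] at h
  rw [fourierPi_eq_unitaryOpPi]
  exact h

/-- **`𝓕² = e^{−iπN}`** (the parity operator `h_α ↦ (−1)^{|α|} h_α`). [cite: Folland1989, §1.7] -/
theorem fourierPi_comp_fourierPi :
    (fourierPi : (SR σ) →L[ℂ] SR σ).comp fourierPi = torusOpPi (fun _ : σ => -π) := by
  rw [fourierPi, ← torusOpPi_add]
  congr 1
  funext l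
  simp only [Pi.add_apply]
  ring

/-- `𝓕² h_α = (−1)^{|α|} h_α`. [cite: Folland1989, §1.7] -/
theorem fourierPi_fourierPi_hermitePi (α : σ →₀ ℕ) :
    fourierPi (fourierPi (hermitePi α)) = (-1 : ℂ) ^ α.degree • (hermitePi α : SR σ) := by
  rw [fourierPi_hermitePi, map_smul, fourierPi_hermitePi, smul_smul, ← mul_pow, neg_mul_neg, Complex.I_mul_I]

/-- **`𝓕⁴ = 1`** on `𝓢(ℝ^σ)`. [cite: Folland1989, §1.7] -/
theorem fourierPi_pow_four (f : SR σ) : fourierPi (fourierPi (fourierPi (fourierPi f))) = f := by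
  have h2 : ∀ g : SR σ, fourierPi (fourierPi g) = torusOpPi (fun _ : σ => -π) g := fun g => by
    rw [← ContinuousLinearMap.comp_apply, fourierPi_comp_fourierPi]
  rw [h2, h2, ← ContinuousLinearMap.comp_apply, ← torusOpPi_add]
  have h0 : ((fun _ : σ => -π) + fun _ : σ => -π) = fun _ : σ => -(2 * π) := by
    funext l; simp only [Pi.add_apply]; ring
  rw [h0]
  refine toL2_injective ?_
  rw [toL2_torusOpPi]
  have ht : torusPt (fun _ : σ => -(2 * π)) = fun _ => (1 : Circle) := by
    funext l
    rw [torusPt, neg_neg, ← Circle.exp_zero, Circle.exp_eq_exp]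
    exact ⟨1, by ring⟩
  rw [ht]
  change schrodingerU (diagHom 1) (toL2 f) = toL2 f
  rw [map_one, schrodingerU_one]

end Covariance

end Literature.Analysis.SegalBargmann
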